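import Literature.AlgebraicGeometry.HodgeTheory.QuaternionicQuarticDeckChartToCover
import Literature.AlgebraicGeometry.HodgeTheory.QuaternionicQuarticDeckChartEtaleEquiv
import Literature.AlgebraicGeometry.Motives.VarietiesGeometricallyIntegralProofs
import Literature.AlgebraicGeometry.Motives.ProjReducedInducedPiece
import HarnessLib

/-!
# The deck chart is an open piece of the reduced cover `𝒱 = cover e` (brick M1-1 «CHART-IN-COVER», assembly)

Layer `Literature/AlgebraicGeometry/HodgeTheory`. Theorems (+ the abbreviation `univCoeffs e = X`); no named fact. Written by
the prover seat `hodge-nonav-19716-p2` (g13, cell `hodge-nonav`) as the assembly of brick **M1-1 «CHART-IN-COVER»** of prover-Bx's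
programme M1 (memo `PROGRAMME-M1-Bx-g19.md` §2; route `HodgeConjecture/Q8SymplecticPowers`, crux K1Q, stmt-HodgeConjecture-24190):
the explicit étale deck chart `Spec (DeckRing X)` over `A = ParamRing e` (prover-Bx, `QuaternionicQuarticDeckChart`) is an OPEN PIECE of
the reduced universal quaternionic quartic `cover e` (`QuaternionicQuarticCover`), namely its piece over `D₊(x₂·H̃)`.

Inputs: the surjection `θ = awayToDeck X he : (A[x]_{(x₂ H̃)})₀ ↠ DeckRing X` killing `Q_e/x₂^{2e+4}`
(`QuaternionicQuarticDeckChartToCover`) and the local uniqueness of reduced induced structures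
(`Motives.ProjSubscheme.exists_isOpenImmersion_subscheme_of_surjective`). Two hypotheses are left EXPLICIT, to be discharged by
prover-Bx's M1-0a′ (the dictionary `DeckRing ≅ (R[u][X]/(X⁴ − g))[1/h]`, a standard étale pair): `[IsReduced (DeckRing X)]` and the
reverse inclusion `awayι⁻¹ V₊(Q_e) ⊆ image (Spec θ)` — for which `range_specMap_awayToDeck_superset_of_ker_le` gives the ring-level
sufficient condition `ker θ ≤ √(Q_e/x₂^{2e+4})`.

* `exists_isOpenImmersion_deckChart_cover` — the open immersion `f : Spec (DeckRing X) ⟶ (cover e).left` with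
  `f ≫ coverEmb e = Spec θ ≫ awayι` and image `coverEmb⁻¹ D₊(x₂ H̃)`;
* `exists_isOpenImmersion_deckChart_cover_over` — the same `f` is a morphism over `Spec A`: `f ≫ (cover e).hom = (deckChart X).hom`.

Honest scope: scheme bookkeeping; nothing here bears on HC.

## References

* [Hartshorne1977] R. Hartshorne, Algebraic Geometry (1977): II Prop. 2.5 (b), II Example 3.2.6.
* [GortzWedhorn2020] U. Görtz, T. Wedhorn, Algebraic Geometry I, 2nd ed. (2020), Prop. 3.52.
* [Kollar2007] J. Kollár, Lectures on Resolution of Singularities (2007), §3.3.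
-/

noncomputable section

set_option backward.isDefEq.respectTransparency false

open CategoryTheory AlgebraicGeometry MvPolynomial HomogeneousLocalization TopologicalSpace
open Literature.AlgebraicGeometry.Motives Literature.AlgebraicGeometry.Motives.UniversalHypersurface

namespace Literature.AlgebraicGeometry.HodgeTheory.Q8Family

attribute [local instance] MvPolynomial.gradedAlgebra

section InCover

variable (e : ℕ)

/-- The universal coefficient vector `a = X` over `A = ParamRing e`. [cite: Kollar2007, §3.3] -/
abbrev univCoeffs : CIdx e → ParamRing e := fun i => X i

/-- The degree of the chart element `x₂ · H̃`. [cite: Hartshorne1977, II Prop. 2.5 (b)] -/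
theorem X_two_mul_branchForm_mem (he : 1 ≤ e) :
    (X 2 * branchForm (univCoeffs e) : MvPolynomial (Fin 4) (ParamRing e)) ∈
      homogeneousSubmodule (Fin (2 + 2)) (ParamRing e) (1 + (e + 2)) :=
  SetLike.mul_mem_graded (isHomogeneous_X (ParamRing e) (2 : Fin 4)) (branchForm_mem (univCoeffs e) he)

/-- `0 < 1 + (e + 2)`. [cite: Hartshorne1977, II Prop. 2.5 (b)] -/
theorem one_add_pos' : 0 < 1 + (e + 2) := by omega

/-- **Ring-level sufficient condition for the reverse inclusion**: if `ker θ ≤ √(Q_e/x₂^{2e+4})` (read in the chart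
`D₊(x₂ H̃)`), then `awayι⁻¹ V₊(Q_e) ⊆ image (Spec θ)` (the image of `Spec` of a surjection is `V(ker)`, Mathlib
`PrimeSpectrum.range_comap_of_surjective`). [cite: Hartshorne1977, II Prop. 2.5 (b)] -/
theorem range_specMap_awayToDeck_superset_of_ker_le (he : 1 ≤ e)
    (hker : RingHom.ker (awayToDeck (univCoeffs e) he) ≤
      (Ideal.span {awayMap (homogeneousSubmodule (Fin (2 + 2)) (ParamRing e)) (branchForm_mem (univCoeffs e) he) rfl
        (Away.isLocalizationElem (isHomogeneous_X (ParamRing e) (2 : Fin 4))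
          ((mem_homogeneousSubmodule _ _).mpr (isHomogeneous_univQ e he)))}).radical) :
    Proj.awayι (homogeneousSubmodule (Fin (2 + 2)) (ParamRing e)) (X 2 * branchForm (univCoeffs e))
        (X_two_mul_branchForm_mem e he) (one_add_pos' e) ⁻¹'
          ProjectiveSpectrum.zeroLocus (homogeneousSubmodule (Fin (2 + 2)) (ParamRing e)) {univQ e} ⊆
        Set.range (Spec.map (CommRingCat.ofHom (awayToDeck (univCoeffs e) he))) := by
  rw [ProjSubscheme.awayι_mul_preimage_zeroLocus _ (isHomogeneous_X (ParamRing e) (2 : Fin 4)) Nat.one_pos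
    (branchForm_mem (univCoeffs e) he) rfl ((mem_homogeneousSubmodule _ _).mpr (isHomogeneous_univQ e he)) (by omega)]
  intro p hp
  have hrange : Set.range (Spec.map (CommRingCat.ofHom (awayToDeck (univCoeffs e) he))) =
      PrimeSpectrum.zeroLocus (RingHom.ker (awayToDeck (univCoeffs e) he)) :=
    range_comap_of_surjective (f := awayToDeck (univCoeffs e) he) (hf := awayToDeck_surjective (univCoeffs e) he)
  rw [hrange, PrimeSpectrum.mem_zeroLocus]
  intro t ht
  have ht' := hker ht
  rw [← PrimeSpectrum.zeroLocus_span, PrimeSpectrum.mem_zeroLocus] at hp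
  exact (p.2.radical_le_iff.mpr hp) ht'

/-- **M1-1 «CHART-IN-COVER» (modulo the two inputs of M1-0a′).** If the deck ring over `A = ParamRing e` is reduced and
the image of `Spec θ : Spec DeckRing ↪ D₊(x₂ H̃)` contains `V₊(Q_e) ∩ D₊(x₂ H̃)` (it is contained in it by
`range_specMap_awayToDeck_subset`), then the deck chart is an OPEN PIECE of the reduced cover: there is an open immersion
`f : Spec (DeckRing X) ⟶ (cover e).left` with `f ≫ coverEmb e = Spec θ ≫ awayι` and image `coverEmb⁻¹ D₊(x₂ H̃)`.
[cite: Hartshorne1977, II Example 3.2.6] [cite: GortzWedhorn2020, Prop. 3.52] -/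
theorem exists_isOpenImmersion_deckChart_cover (he : 1 ≤ e) [IsReduced (DeckRing (univCoeffs e))]
    (hrange : Proj.awayι (homogeneousSubmodule (Fin (2 + 2)) (ParamRing e)) (X 2 * branchForm (univCoeffs e))
        (X_two_mul_branchForm_mem e he) (one_add_pos' e) ⁻¹'
          ProjectiveSpectrum.zeroLocus (homogeneousSubmodule (Fin (2 + 2)) (ParamRing e)) {univQ e} ⊆
        Set.range (Spec.map (CommRingCat.ofHom (awayToDeck (univCoeffs e) he)))) :
    ∃ (f : Spec (.of (DeckRing (univCoeffs e))) ⟶ (cover e).left) (_ : IsOpenImmersion f),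
      f ≫ coverEmb e = Spec.map (CommRingCat.ofHom (awayToDeck (univCoeffs e) he)) ≫
        Proj.awayι (homogeneousSubmodule (Fin (2 + 2)) (ParamRing e)) (X 2 * branchForm (univCoeffs e))
          (X_two_mul_branchForm_mem e he) (one_add_pos' e) ∧
      f.opensRange = coverEmb e ⁻¹ᵁ
        Proj.basicOpen (homogeneousSubmodule (Fin (2 + 2)) (ParamRing e)) (X 2 * branchForm (univCoeffs e)) := by
  have hsub := range_specMap_awayToDeck_subset (univCoeffs e) he
    ((mem_homogeneousSubmodule _ _).mpr (isHomogeneous_univQ e he))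
  exact ProjSubscheme.exists_isOpenImmersion_subscheme_of_surjective
    (homogeneousSubmodule (Fin (2 + 2)) (ParamRing e)) (X_two_mul_branchForm_mem e he) (one_add_pos' e)
    (zeroLocusClosed e) (awayToDeck (univCoeffs e) he) (awayToDeck_surjective (univCoeffs e) he)
    (Set.Subset.antisymm hsub hrange)

/-- Under the same inputs, the open immersion is a morphism OVER `Spec A`: `f ≫ (cover e).hom = (deckChart X).hom`
(`deckChart X = specOver A (DeckRing X)` by `rfl`, `QuaternionicQuarticDeckChartAction`).
[cite: Hartshorne1977, II Prop. 2.5 (b)] -/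
theorem exists_isOpenImmersion_deckChart_cover_over (he : 1 ≤ e) [IsReduced (DeckRing (univCoeffs e))]
    (hrange : Proj.awayι (homogeneousSubmodule (Fin (2 + 2)) (ParamRing e)) (X 2 * branchForm (univCoeffs e))
        (X_two_mul_branchForm_mem e he) (one_add_pos' e) ⁻¹'
          ProjectiveSpectrum.zeroLocus (homogeneousSubmodule (Fin (2 + 2)) (ParamRing e)) {univQ e} ⊆
        Set.range (Spec.map (CommRingCat.ofHom (awayToDeck (univCoeffs e) he)))) :
    ∃ (f : Spec (.of (DeckRing (univCoeffs e))) ⟶ (cover e).left) (_ : IsOpenImmersion f),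
      f ≫ (cover e).hom = (specOver (ParamRing e) (DeckRing (univCoeffs e))).hom ∧
      f.opensRange = coverEmb e ⁻¹ᵁ
        Proj.basicOpen (homogeneousSubmodule (Fin (2 + 2)) (ParamRing e)) (X 2 * branchForm (univCoeffs e)) := by
  obtain ⟨f, hf, hfac, hran⟩ := exists_isOpenImmersion_deckChart_cover e he hrange
  refine ⟨f, hf, ?_, hran⟩
  rw [cover_hom, ← Category.assoc, hfac, Category.assoc, ProjBaseChangeRing.awayι_projToSpec,
    specMap_awayToDeck_comp_specMap_algebraMap]
  rfl

end InCover

/-! ### Discharging the two inputs from the standard étale dictionary (prover-Bx, M1-0a′) -/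

section Dictionary

variable {R : Type} [CommRing R] {e : ℕ} (a : CIdx e → R)

attribute [local instance] baseAlgebra isScalarTower_base ProjBaseChange.algebraBase ProjBaseChange.isScalarTower_localization

/-- The base variables `R[u₀, u₁] → R[y₀, y₁, y₂]`, `uⱼ ↦ yⱼ`. [cite: Hartshorne1977, II Prop. 2.5 (b)] -/
def toThree : MvPolynomial (Fin 2) R →ₐ[R] MvPolynomial (Fin 3) R :=
  aeval ![X 0, X 1]

/-- `toThree ∘ dehom₂ = dehomogenize 2 ∘ rename castSucc` (both are `x ↦ (y₀, y₁, 1)`). [cite: Hartshorne1977, II Prop. 2.5 (b)] -/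
theorem toThree_dehom₂ (p : MvPolynomial (Fin 3) R) :
    toThree (dehom₂ p) = ProjectiveSpace.dehomogenize R (2 : Fin 4) (rename Fin.castSucc p) := by
  change (toThree.comp dehom₂) p = ((ProjectiveSpace.dehomogenize R (2 : Fin 4)).comp (rename Fin.castSucc)) p
  congr 1
  refine MvPolynomial.algHom_ext fun i => ?_
  fin_cases i <;> simp [toThree, dehom₂, ProjectiveSpace.dehomogenize, Fin.insertNth_apply_below]

/-- `toThree α = y₀ − y₁ = (x₀ − x₁)(y₀, y₁, 1)`. [cite: Kollar2007, §3.3] -/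
theorem toThree_α₂ :
    toThree (α₂ : MvPolynomial (Fin 2) R) = ProjectiveSpace.dehomogenize R (2 : Fin 4) (rename Fin.castSucc (X 0 - X 1)) := by
  rw [← toThree_dehom₂]
  congr 1
  simp [α₂, dehom₂]

/-- The dehomogenised quaternionic quartic is `y₂⁴ − g(y₀, y₁)`. [cite: Kollar2007, §3.3] -/
theorem dehomogenize_quarticFormR_eq :
    ProjectiveSpace.dehomogenize R (2 : Fin 4) (quarticFormR e (cOfR a) (ψOfR a)) = X 2 ^ 4 - toThree (g₂ a) := by
  have h3 : (Fin.last 3 : Fin 4) = (2 : Fin 4).succAbove 2 := by decide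
  have h2 : (Fin.castSucc 2 : Fin 4) = 2 := by decide
  rw [quarticFormR, map_sub, map_mul, map_pow, map_pow, h3, ProjectiveSpace.dehomogenize_X_succAbove, h2,
    ProjectiveSpace.dehomogenize_X_self, one_pow, mul_one]
  simp only [g₂, c₂, c₂', ψ₂, map_mul, map_pow, toThree_dehom₂, toThree_α₂]
  ring

/-- The dehomogenised branch form is `h(y₀, y₁)`. [cite: Kollar2007, §3.3] -/
theorem dehomogenize_branchForm_eq :
    ProjectiveSpace.dehomogenize R (2 : Fin 4) (branchForm a) = toThree (h₂ a) := by
  rw [branchForm]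
  simp only [h₂, c₂, c₂', ψ₂, map_mul, toThree_dehom₂, toThree_α₂]

/-- The dehomogenised quartic `q = y₂⁴ − g ∈ R[y₀,y₁,y₂]`. [cite: Kollar2007, §3.3] -/
abbrev qY : MvPolynomial (Fin 3) R := ProjectiveSpace.dehomogenize R (2 : Fin 4) (quarticFormR e (cOfR a) (ψOfR a))

/-- The dehomogenised branch form `h ∈ R[y₀,y₁,y₂]`. [cite: Kollar2007, §3.3] -/
abbrev hY : MvPolynomial (Fin 3) R := ProjectiveSpace.dehomogenize R (2 : Fin 4) (branchForm a)

/-- `R[y]/(q)`. [cite: Hartshorne1977, II Prop. 2.5 (b)] -/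
abbrev QuotY : Type := MvPolynomial (Fin 3) R ⧸ Ideal.span {qY a}

/-- **The comparison ring** `C = (R[y]/(q))[1/h]`. [cite: Hartshorne1977, II Prop. 2.5 (b)] -/
abbrev CompRing : Type := Localization.Away (Ideal.Quotient.mk (Ideal.span {qY a}) (hY a))

/-- `κ : R[y₀, y₁, y₂] → C`. [cite: Hartshorne1977, II Prop. 2.5 (b)] -/
def compMap : MvPolynomial (Fin 3) R →+* CompRing a :=
  (algebraMap (QuotY a) (CompRing a)).comp (Ideal.Quotient.mk (Ideal.span {qY a}))

/-- `κ` unfolded. [cite: Hartshorne1977, II Prop. 2.5 (b)] -/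
theorem compMap_apply (p : MvPolynomial (Fin 3) R) :
    compMap a p = algebraMap (QuotY a) (CompRing a) (Ideal.Quotient.mk (Ideal.span {qY a}) p) := rfl

/-- `κ(q) = 0`. [cite: Hartshorne1977, II Prop. 2.5 (b)] -/
theorem compMap_qY : compMap a (qY a) = 0 := by
  rw [compMap_apply, Ideal.Quotient.eq_zero_iff_mem.mpr (Ideal.mem_span_singleton_self _), map_zero]

/-- `κ(h)` is a unit. [cite: Hartshorne1977, II Prop. 2.5 (b)] -/
theorem isUnit_compMap_hY : IsUnit (compMap a (hY a)) :=
  IsLocalization.Away.algebraMap_isUnit (S := CompRing a) (Ideal.Quotient.mk (Ideal.span {qY a}) (hY a))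

/-- The `R[u₀,u₁]`-algebra structure on `C` (`uⱼ ↦ κ(yⱼ)`), used as a local instance inside proofs. [cite: Hartshorne1977, II Prop. 2.5 (b)] -/
@[reducible] def compAlgebra : Algebra (MvPolynomial (Fin 2) R) (CompRing a) :=
  ((compMap a).comp (toThree (R := R)).toRingHom).toAlgebra

/-- The structure map of `compAlgebra` unfolded. [cite: Hartshorne1977, II Prop. 2.5 (b)] -/
theorem algebraMap_compAlgebra_apply (p : MvPolynomial (Fin 2) R) :
    letI := compAlgebra a
    algebraMap (MvPolynomial (Fin 2) R) (CompRing a) p = compMap a (toThree p) := rfl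

variable [Algebra ℂ R] (he : 1 ≤ e)

/-- **The deck chart over a DOMAIN is reduced**: it is étale over `R[u₀, u₁]` (`etale_deckRing`, the standard étale pair
`(X⁴ − g, h)`) and étale algebras over domains are reduced (`Motives.isReduced_of_etale_of_isDomain`).
[cite: GortzWedhorn2020, Prop. 3.52] -/
theorem isReduced_deckRing [IsDomain R] : IsReduced (DeckRing a) := by
  haveI : Algebra.Etale (MvPolynomial (Fin 2) R) (DeckRing a) := etale_deckRing a
  exact Motives.isReduced_of_etale_of_isDomain (MvPolynomial (Fin 2) R) (DeckRing a)

/-- `κ(y₂)` is a root of `f = X⁴ − g` with `g(κ y₂) = κ(h)` invertible. [cite: StacksProject, Tag 00UB] -/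
theorem hasMap_comp : letI := compAlgebra a; (deckPair a).HasMap (compMap a (X 2)) := by
  letI := compAlgebra a
  constructor
  · rw [deckPair_f, map_sub, map_pow, Polynomial.aeval_X, Polynomial.aeval_C, algebraMap_compAlgebra_apply,
      ← map_pow, ← map_sub, ← dehomogenize_quarticFormR_eq]
    exact compMap_qY a
  · rw [deckPair_g, Polynomial.aeval_C, algebraMap_compAlgebra_apply, ← dehomogenize_branchForm_eq]
    exact isUnit_compMap_hY a

/-- **`ξ : DeckRing → C`**: the standard étale dictionary `DeckRing ≅ R₀[X][Y]/(f, Yh − 1)` (`deckToPair`) followed by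
the universal map `X ↦ κ(y₂)` (`StandardEtalePair.lift`). [cite: StacksProject, Tag 00UB] -/
def deckToComp : DeckRing a →+* CompRing a :=
  letI := compAlgebra a
  (((deckPair a).lift _ (hasMap_comp a)).comp (deckToPair a)).toRingHom

/-- `ξ` is `R[u₀,u₁]`-linear. [cite: StacksProject, Tag 00UB] -/
theorem deckToComp_algebraMap (p : MvPolynomial (Fin 2) R) :
    deckToComp a (algebraMap (MvPolynomial (Fin 2) R) (DeckRing a) p) = compMap a (toThree p) := by
  letI := compAlgebra a
  change (((deckPair a).lift _ (hasMap_comp a)).comp (deckToPair a)) (algebraMap _ _ p) = _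
  rw [AlgHom.commutes]
  rfl

/-- `ξ(w) = κ(y₂)`. [cite: StacksProject, Tag 00UB] -/
theorem deckToComp_mk_X_two : deckToComp a (Ideal.Quotient.mk (deckIdeal a) (X 2)) = compMap a (X 2) := by
  letI := compAlgebra a
  change (((deckPair a).lift _ (hasMap_comp a)).comp (deckToPair a)) (Ideal.Quotient.mk (deckIdeal a) (X 2)) = _
  rw [AlgHom.comp_apply, deckToPair_mk, deckToPairPoly_X]
  exact (deckPair a).lift_X _ (hasMap_comp a)

/-- **`ξ ∘ θ₀ = κ`**: on `y₀, y₁` both are the structure map of `R₀`, on `y₂` both give `κ(y₂)` (`lift_X`).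
[cite: StacksProject, Tag 00UB] -/
theorem deckToComp_comp_chartToDeck :
    (deckToComp a).comp (chartToDeck a : MvPolynomial (Fin 3) R →+* DeckRing a) = compMap a := by
  refine MvPolynomial.ringHom_ext (fun r => ?_) (fun i => ?_)
  · rw [RingHom.comp_apply, ← MvPolynomial.algebraMap_eq]
    change deckToComp a (chartToDeck a (algebraMap R _ r)) = _
    rw [AlgHom.commutes, IsScalarTower.algebraMap_apply R (MvPolynomial (Fin 2) R) (DeckRing a), deckToComp_algebraMap,
      MvPolynomial.algebraMap_eq, algHom_C, MvPolynomial.algebraMap_eq]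
  · rw [RingHom.comp_apply]
    change deckToComp a (chartToDeck a (X i)) = _
    have hgen : ∀ j : Fin 3, chartToDeck a (X j) = Ideal.Quotient.mk (deckIdeal a) (X (Fin.castLE (by omega) j)) := by
      intro j; fin_cases j <;> simp [chartToDeck]
    rw [hgen]
    fin_cases i
    · change deckToComp a (Ideal.Quotient.mk (deckIdeal a) (X 0)) = compMap a (X 0)
      rw [← toSix_X0, ← algebraMap_base_apply, deckToComp_algebraMap]
      simp [toThree]
    · change deckToComp a (Ideal.Quotient.mk (deckIdeal a) (X 1)) = compMap a (X 1)
      rw [← toSix_X1, ← algebraMap_base_apply, deckToComp_algebraMap]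
      simp [toThree]
    · exact deckToComp_mk_X_two a

/-- **`ker θ ⊆ (Q/x₂^{2e+4})`** in `(R[x]_{(x₂ H̃)})₀`: an element killed by `θ` is `p/hⁿ` with `θ₀(p) = 0`, hence
`κ(p) = ξ(θ₀ p) = 0`, i.e. `hᵐ p ∈ (q)` in `R[y]`; and `h` is a unit of the chart ring. [cite: StacksProject, Tag 00UB] -/
theorem ker_awayToDeck_le
    (hQ : quarticFormR e (cOfR a) (ψOfR a) ∈ homogeneousSubmodule (Fin (2 + 2)) R (2 * e + 4)) :
    RingHom.ker (awayToDeck a he) ≤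
      Ideal.span {awayMap (homogeneousSubmodule (Fin (2 + 2)) R) (branchForm_mem a he) rfl
        (Away.isLocalizationElem (isHomogeneous_X R (2 : Fin 4)) hQ)} := by
  letI := (SmoothHypersurface.chartMap R (2 : Fin 4) (branchForm_mem a he)).toRingHom.toAlgebra
  haveI := SmoothHypersurface.isLocalization_chartMap R (2 : Fin 4) (branchForm_mem a he)
  intro t ht
  rw [← SmoothHypersurface.chartMap_dehomogenize R (2 : Fin 4) (branchForm_mem a he) _ hQ]
  -- `t · h^n = p`
  obtain ⟨⟨p, ⟨_, n, rfl⟩⟩, hpt⟩ := IsLocalization.surj (Submonoid.powers (hY a)) t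
  change t * algebraMap _ _ (hY a ^ n) = algebraMap _ _ p at hpt
  -- `θ₀ p = 0`, hence `κ p = 0`
  have hθp : chartToDeck a p = 0 := by
    rw [← awayToDeck_chartMap a he p]
    change awayToDeck a he (algebraMap _ _ p) = 0
    rw [← hpt, map_mul, RingHom.mem_ker.mp ht, zero_mul]
  have hκp : compMap a p = 0 := by
    rw [← deckToComp_comp_chartToDeck a, RingHom.comp_apply]
    change deckToComp a (chartToDeck a p) = 0
    rw [hθp, map_zero]
  -- `h^m p ∈ (q)` in `R[y]`
  rw [compMap_apply, IsLocalization.map_eq_zero_iff (Submonoid.powers (Ideal.Quotient.mk (Ideal.span {qY a}) (hY a)))]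
    at hκp
  obtain ⟨⟨_, m, rfl⟩, hm⟩ := hκp
  change (Ideal.Quotient.mk (Ideal.span {qY a}) (hY a)) ^ m * Ideal.Quotient.mk (Ideal.span {qY a}) p = 0 at hm
  rw [← map_pow, ← map_mul, Ideal.Quotient.eq_zero_iff_mem, Ideal.mem_span_singleton] at hm
  obtain ⟨r, hr⟩ := hm
  -- transport to the chart ring
  have hunit : IsUnit (algebraMap (MvPolynomial (Fin 3) R)
      (Away (homogeneousSubmodule (Fin (2 + 2)) R) (X 2 * branchForm a)) (hY a)) :=
    IsLocalization.Away.algebraMap_isUnit _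
  rw [map_pow] at hpt
  have key : algebraMap _ (Away (homogeneousSubmodule (Fin (2 + 2)) R) (X 2 * branchForm a)) (hY a) ^ (m + n) * t =
      SmoothHypersurface.chartMap R (2 : Fin 4) (branchForm_mem a he) (qY a) * algebraMap _ _ r := by
    change _ = algebraMap _ _ (qY a) * algebraMap _ _ r
    rw [← map_mul, ← hr, map_mul, map_pow, pow_add, mul_assoc,
      mul_comm (algebraMap _ (Away (homogeneousSubmodule (Fin (2 + 2)) R) (X 2 * branchForm a)) (hY a) ^ n) t, hpt]
  rw [Ideal.mem_span_singleton]
  refine ⟨((hunit.pow (m + n)).unit⁻¹ : (Away (homogeneousSubmodule (Fin (2 + 2)) R) (X 2 * branchForm a))ˣ) *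
    algebraMap _ _ r, ?_⟩
  rw [mul_left_comm, ← key, ← mul_assoc, IsUnit.val_inv_mul, one_mul]

end Dictionary

/-! ### M1-1 «CHART-IN-COVER», unconditional -/

section Unconditional

variable (e : ℕ)

attribute [local instance] baseAlgebra isScalarTower_base

/-- **The deck chart is an open piece of the reduced cover** (unconditional): there is an open immersion
`f : Spec (DeckRing X) ⟶ (cover e).left` OVER `Spec A` (`f ≫ (cover e).hom = (deckChart X).hom`) with image
`coverEmb⁻¹ D₊(x₂·H̃)` (`e ≥ 1`). [cite: Hartshorne1977, II Example 3.2.6] [cite: GortzWedhorn2020, Prop. 3.52] -/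
theorem exists_chartEmb (he : 1 ≤ e) :
    ∃ (f : Spec (.of (DeckRing (univCoeffs e))) ⟶ (cover e).left) (_ : IsOpenImmersion f),
      f ≫ (cover e).hom = (specOver (ParamRing e) (DeckRing (univCoeffs e))).hom ∧
      f ≫ coverEmb e = Spec.map (CommRingCat.ofHom (awayToDeck (univCoeffs e) he)) ≫
        Proj.awayι (homogeneousSubmodule (Fin (2 + 2)) (ParamRing e)) (X 2 * branchForm (univCoeffs e))
          (X_two_mul_branchForm_mem e he) (one_add_pos' e) ∧
      f.opensRange = coverEmb e ⁻¹ᵁ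
        Proj.basicOpen (homogeneousSubmodule (Fin (2 + 2)) (ParamRing e)) (X 2 * branchForm (univCoeffs e)) := by
  haveI : IsReduced (DeckRing (univCoeffs e)) := isReduced_deckRing (univCoeffs e)
  have hrange := range_specMap_awayToDeck_superset_of_ker_le e he
    ((ker_awayToDeck_le (univCoeffs e) he ((mem_homogeneousSubmodule _ _).mpr (isHomogeneous_univQ e he))).trans
      Ideal.le_radical)
  obtain ⟨f, hf, hfac, hran⟩ := exists_isOpenImmersion_deckChart_cover e he hrange
  refine ⟨f, hf, ?_, hfac, hran⟩
  rw [cover_hom, ← Category.assoc, hfac, Category.assoc, ProjBaseChangeRing.awayι_projToSpec,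
    specMap_awayToDeck_comp_specMap_algebraMap]
  rfl

end Unconditional

end Literature.AlgebraicGeometry.HodgeTheory.Q8Family

end
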